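import Mathlib
import HarnessLib
import Literature.Computability.Complexity.FourierTails

/-!
# PneNP / OverlapGapAlgebra — `SearchHardWindow`, Line A rung: the Fourier-truncation surrogate

Stub `stub_truncationSurrogate` of the skeleton of crux `stmt-PneNP-2460` (`SearchHardWindow`),
Line A (approx-degree ladder), first rung (AC⁰ circuit families): the pure cube-Fourier step
(O'Donnell 2014, §1.4 and §3.1; the Linial–Mansour–Nisan approximation by the low-degree part)
turning `n'` Boolean functions `g_v : {0,1}^N → {0,1}` with small Fourier tails
`W^{≥D}[sgn ∘ g_v] ≤ τ` into a *saturated low-degree sign surrogate*: coefficients `c v S`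
supported below level `D`, of total energy `∑_x ∑_v p_v(x)² ≤ 9 n' 2^N` for
`p_v = ∑_S c v S · χ_S`, such that outside at most `9 n' τ 2^N` points `x` every `p_v(x)` has
modulus `≥ 1` and the sign of `g_v(x)` (`0 ≤ p_v(x) ↔ g_v(x) = true`; recall the tree's
convention `sgn true = -1`).

Construction: `p_v = -3 · T_{<D} h_v` with `h_v = sgn ∘ g_v` and `T_{<D} h = ∑_{|S|<D} ĥ(S) χ_S`
the truncation of the Fourier–Walsh expansion below level `D`, i.e.
`c v S = if |S| < D then -3 ĥ_v(S) else 0` (`ĥ = cubeFourierCoeff h`, `χ_S = walsh S`). Then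
* energy (`shw_energy`): `∑_x (T_{<D} h_v)(x)² = 2^N ∑_{|S|<D} ĥ_v(S)² ≤ 2^N ∑_S ĥ_v(S)² = 2^N`
  (orthogonality `shw_sum_sq_sum_mul_walsh`, Parseval `sum_cubeFourierCoeff_sq`);
* tail (`shw_tail_energy`): `h_v - T_{<D} h_v = ∑_{|S| ≥ D} ĥ_v(S) χ_S` has
  `∑_x (h_v - T_{<D} h_v)(x)² = 2^N · W^{≥D}[h_v]`, so by Markov at most `9 · 2^N · W^{≥D}[h_v]`
  points have `|h_v - T_{<D} h_v| ≥ 1/3` (`shw_bad_card_le`);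
* at every other point `|p_v| > 2` with the sign of `-h_v`, i.e. `0 ≤ p_v ↔ g_v = true`
  (`shw_good`, Fourier inversion `shw_eval`);
* a union bound over `v` (`stub_truncationSurrogate`).

No new definitions: the surrogate coefficients and the tail are written out as the explicit
`if |S| < D then -3 ĥ(S) else 0` and `∑_{S} (if D ≤ |S| then ĥ(S) else 0) χ_S(x)`.
The hypothesis `1 ≤ D` of the registered stub signature is part of the rung's bookkeeping and is
not used by these bounds (for `D = 0` the surrogate is `0` and `W^{≥0} = 1` makes the third bound
trivial).

Prover prover-line-stmt-PneNP-2460-0, 2026-08-16.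

## References

* R. O'Donnell, *Analysis of Boolean Functions*, CUP 2014, §1.4 (Parseval, Thm 1.1 inversion),
  §3.1 (low-degree truncation, spectral concentration) [ODonnell2014].
* N. Linial, Y. Mansour, N. Nisan, *Constant depth circuits, Fourier transform, and
  learnability*, J. ACM 40 (1993) (approximation of AC⁰ by the low-degree part)
  [LinialMansourNisan1993].
-/

-- `Summit.PneNP.PneNP.…` is the tree's mandated namespace (summit = sub-problem name).
set_option linter.dupNamespace false

noncomputable section

namespace Summit.PneNP.PneNP.Theorems

open Finset Literature.Computability.Complexity Literature.Computability.Complexity.LowDegree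
open Literature.Probability.RandomGraphs.LowDegree (sgn walsh)
open scoped Classical

/-! ### Walsh sums with prescribed coefficients -/

/-- **Orthogonality, squared form**: `∑_x (∑_S c_S χ_S(x))² = 2^N ∑_S c_S²`.
[cite: ODonnell2014, §1.4] -/
theorem shw_sum_sq_sum_mul_walsh {N : ℕ} (c : Finset (Fin N) → ℝ) :
    ∑ x : Fin N → Bool, (∑ S, c S * walsh S x) ^ 2 = 2 ^ N * ∑ S, c S ^ 2 := by
  -- adapted from `sum_sq_sum_mul_walsh` of
  -- Literature/Computability/QuantumComplexity/InfluenceBounds.lean (not imported: quantum files)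
  calc ∑ x : Fin N → Bool, (∑ S, c S * walsh S x) ^ 2
      = ∑ x : Fin N → Bool, ∑ S, ∑ T, c S * c T * (walsh S x * walsh T x) := by
        refine Finset.sum_congr rfl fun x _ => ?_
        rw [sq, Finset.sum_mul_sum]
        exact Finset.sum_congr rfl fun S _ => Finset.sum_congr rfl fun T _ => by ring
    _ = ∑ S, ∑ T, c S * c T * ∑ x : Fin N → Bool, walsh S x * walsh T x := by
        rw [Finset.sum_comm]
        refine Finset.sum_congr rfl fun S _ => ?_
        rw [Finset.sum_comm]
        exact Finset.sum_congr rfl fun T _ => by rw [Finset.mul_sum]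
    _ = ∑ S, c S * c S * 2 ^ N := by
        refine Finset.sum_congr rfl fun S _ => ?_
        simp_rw [sum_walsh_mul_walsh_index]
        simp
    _ = 2 ^ N * ∑ S, c S ^ 2 := by
        rw [Finset.mul_sum]
        exact Finset.sum_congr rfl fun S _ => by ring

/-! ### The surrogate of one Boolean function

For `f : {0,1}^N → {0,1}` and `h = sgn ∘ f` the surrogate is `∑_S c_S χ_S` with
`c_S = if |S| < D then -3 ĥ(S) else 0`, and the tail is
`∑_S (if D ≤ |S| then ĥ(S) else 0) χ_S`. -/

/-- `±1`-valued functions have unit Parseval mass: `∑_S ĥ(S)² = 𝔼 h² = 1` for `h = sgn ∘ f`.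
[cite: ODonnell2014, §1.4] -/
theorem shw_sum_sq_coeff_sgn {N : ℕ} (f : (Fin N → Bool) → Bool) :
    ∑ S, cubeFourierCoeff (fun y => sgn (f y)) S ^ 2 = 1 := by
  rw [sum_cubeFourierCoeff_sq]
  have hsq : ∀ x, sgn (f x) ^ 2 = 1 := fun x => by cases f x <;> norm_num [sgn]
  simp only [hsq, sum_const, card_univ, Fintype.card_fun, Fintype.card_bool, Fintype.card_fin,
    nsmul_eq_mul, mul_one, Nat.cast_pow, Nat.cast_ofNat]
  exact div_self (by positivity)

/-- **Energy of the surrogate**: `∑_x (∑_{|S|<D} (-3 ĥ(S)) χ_S(x))² ≤ 9 · 2^N`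
(`= 9 · 2^N ∑_{|S|<D} ĥ(S)² ≤ 9 · 2^N ∑_S ĥ(S)² = 9 · 2^N` by orthogonality and Parseval).
[cite: ODonnell2014, §1.4] -/
theorem shw_energy {N : ℕ} (D : ℕ) (f : (Fin N → Bool) → Bool) :
    ∑ x : Fin N → Bool, (∑ S,
        (if S.card < D then -3 * cubeFourierCoeff (fun y => sgn (f y)) S else 0) * walsh S x) ^ 2
      ≤ 9 * 2 ^ N := by
  rw [shw_sum_sq_sum_mul_walsh]
  have hle : ∑ S : Finset (Fin N),
      (if S.card < D then -3 * cubeFourierCoeff (fun y => sgn (f y)) S else 0) ^ 2 ≤ 9 := by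
    calc ∑ S : Finset (Fin N),
          (if S.card < D then -3 * cubeFourierCoeff (fun y => sgn (f y)) S else 0) ^ 2
          ≤ ∑ S, 9 * cubeFourierCoeff (fun y => sgn (f y)) S ^ 2 := by
            refine Finset.sum_le_sum fun S _ => ?_
            split_ifs
            · exact le_of_eq (by ring)
            · rw [zero_pow two_ne_zero]; positivity
      _ = 9 := by rw [← Finset.mul_sum, shw_sum_sq_coeff_sgn, mul_one]
  have h2 : (0 : ℝ) ≤ 2 ^ N := by positivity
  calc (2 : ℝ) ^ N * ∑ S : Finset (Fin N),
        (if S.card < D then -3 * cubeFourierCoeff (fun y => sgn (f y)) S else 0) ^ 2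
        ≤ 2 ^ N * 9 := mul_le_mul_of_nonneg_left hle h2
    _ = 9 * 2 ^ N := by ring

/-- **Value of the surrogate**: `∑_{|S|<D} (-3 ĥ(S)) χ_S(x) = -3 (h(x) - ∑_{|S| ≥ D} ĥ(S) χ_S(x))`,
by Fourier inversion `h = ∑_S ĥ(S) χ_S` split at level `D`. [cite: ODonnell2014, Thm 1.1] -/
theorem shw_eval {N : ℕ} (D : ℕ) (f : (Fin N → Bool) → Bool) (x : Fin N → Bool) :
    ∑ S, (if S.card < D then -3 * cubeFourierCoeff (fun y => sgn (f y)) S else 0) * walsh S x =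
      -3 * (sgn (f x) -
        ∑ S, (if D ≤ S.card then cubeFourierCoeff (fun y => sgn (f y)) S else 0) *
          walsh S x) := by
  have hinv : sgn (f x) = ∑ S, cubeFourierCoeff (fun y => sgn (f y)) S * walsh S x :=
    (sum_cubeFourierCoeff_mul_walsh (fun y => sgn (f y)) x).symm
  rw [hinv, ← Finset.sum_sub_distrib, Finset.mul_sum]
  refine Finset.sum_congr rfl fun S _ => ?_
  by_cases hS : S.card < D
  · rw [if_pos hS, if_neg (not_le.2 hS)]; ring
  · rw [if_neg hS, if_pos (not_lt.1 hS)]; ring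

/-- **Energy of the tail**: `∑_x (∑_{|S| ≥ D} ĥ(S) χ_S(x))² = 2^N · W^{≥D}[h]` (orthogonality).
[cite: ODonnell2014, §1.4] -/
theorem shw_tail_energy {N : ℕ} (D : ℕ) (f : (Fin N → Bool) → Bool) :
    ∑ x : Fin N → Bool,
        (∑ S, (if D ≤ S.card then cubeFourierCoeff (fun y => sgn (f y)) S else 0) *
          walsh S x) ^ 2
      = 2 ^ N * tailWeight (fun y => sgn (f y)) D := by
  rw [shw_sum_sq_sum_mul_walsh, tailWeight, Finset.sum_filter]
  congr 1
  refine Finset.sum_congr rfl fun S _ => ?_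
  split_ifs
  · rfl
  · exact zero_pow two_ne_zero

/-- **Good points**: if `|t| < 1/3` then `p = -3 (sgn b - t)` has `|p| ≥ 1` (indeed `|p| > 2`)
and the sign of `b`, i.e. `0 ≤ p ↔ b = true` (as `sgn true = -1`, `sgn false = 1`). [folklore] -/
theorem shw_good {p t : ℝ} {b : Bool} (hp : p = -3 * (sgn b - t)) (ht : |t| < 3⁻¹) :
    1 ≤ |p| ∧ decide (0 ≤ p) = b := by
  rw [abs_lt] at ht
  obtain ⟨ht1, ht2⟩ := ht
  cases b
  · have hsgn : sgn false = 1 := rfl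
    rw [hsgn] at hp
    have hp2 : p < -2 := by rw [hp]; linarith
    refine ⟨?_, ?_⟩
    · rw [abs_of_neg (by linarith)]; linarith
    · rw [decide_eq_false_iff_not, not_le]; linarith
  · have hsgn : sgn true = -1 := rfl
    rw [hsgn] at hp
    have hp2 : 2 < p := by rw [hp]; linarith
    refine ⟨?_, ?_⟩
    · rw [abs_of_pos (by linarith)]; linarith
    · rw [decide_eq_true_eq]; linarith

/-- **Few bad points** (Markov on the squared tail): every point where the surrogate fails to
have modulus `≥ 1` and the sign of `f` has `|tail| ≥ 1/3`, and there are at most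
`9 · ∑_x tail(x)² = 9 · 2^N · W^{≥D}[h]` such points. [cite: ODonnell2014, §3.1] -/
theorem shw_bad_card_le {N : ℕ} (D : ℕ) (f : (Fin N → Bool) → Bool) :
    (((univ : Finset (Fin N → Bool)).filter fun x =>
        ¬ (1 ≤ |∑ S, (if S.card < D then -3 * cubeFourierCoeff (fun y => sgn (f y)) S else 0) *
              walsh S x| ∧
          decide (0 ≤ ∑ S,
              (if S.card < D then -3 * cubeFourierCoeff (fun y => sgn (f y)) S else 0) *
                walsh S x) = f x)).card : ℝ)
      ≤ 9 * (2 ^ N * tailWeight (fun y => sgn (f y)) D) := by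
  -- the tail `h - T_{<D} h` and the Markov set `B = {x | |tail x| ≥ 1/3}`
  set t : (Fin N → Bool) → ℝ := fun x =>
    ∑ S, (if D ≤ S.card then cubeFourierCoeff (fun y => sgn (f y)) S else 0) * walsh S x with ht
  set B : Finset (Fin N → Bool) := univ.filter fun x => (3 : ℝ)⁻¹ ≤ |t x| with hB
  have hsub : ((univ : Finset (Fin N → Bool)).filter fun x =>
      ¬ (1 ≤ |∑ S, (if S.card < D then -3 * cubeFourierCoeff (fun y => sgn (f y)) S else 0) *
            walsh S x| ∧
        decide (0 ≤ ∑ S,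
            (if S.card < D then -3 * cubeFourierCoeff (fun y => sgn (f y)) S else 0) *
              walsh S x) = f x)) ⊆ B := by
    intro x hx
    rw [hB, mem_filter]
    refine ⟨mem_univ _, ?_⟩
    by_contra hlt
    have htx : t x =
        ∑ S, (if D ≤ S.card then cubeFourierCoeff (fun y => sgn (f y)) S else 0) *
          walsh S x := by
      rw [ht]
    exact (mem_filter.1 hx).2 (shw_good (t := t x) (htx ▸ shw_eval D f x) (not_le.1 hlt))
  have henergy : ∑ x, t x ^ 2 = 2 ^ N * tailWeight (fun y => sgn (f y)) D := by
    rw [ht]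
    exact shw_tail_energy D f
  have hmk : (3 : ℝ)⁻¹ ^ 2 * (B.card : ℝ) ≤ 2 ^ N * tailWeight (fun y => sgn (f y)) D := by
    rw [← henergy]
    calc (3 : ℝ)⁻¹ ^ 2 * (B.card : ℝ) = ∑ _x ∈ B, (3 : ℝ)⁻¹ ^ 2 := by
          rw [sum_const, nsmul_eq_mul, mul_comm]
      _ ≤ ∑ x ∈ B, t x ^ 2 := by
          refine Finset.sum_le_sum fun x hx => ?_
          have h3 : (3 : ℝ)⁻¹ ≤ |t x| := by
            rw [hB] at hx
            exact (mem_filter.1 hx).2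
          calc (3 : ℝ)⁻¹ ^ 2 ≤ |t x| ^ 2 := pow_le_pow_left₀ (by norm_num) h3 2
            _ = t x ^ 2 := sq_abs _
      _ ≤ ∑ x, t x ^ 2 :=
          Finset.sum_le_sum_of_subset_of_nonneg (Finset.subset_univ B) fun _ _ _ => sq_nonneg _
  calc (((univ : Finset (Fin N → Bool)).filter fun x =>
        ¬ (1 ≤ |∑ S, (if S.card < D then -3 * cubeFourierCoeff (fun y => sgn (f y)) S else 0) *
              walsh S x| ∧
          decide (0 ≤ ∑ S,
              (if S.card < D then -3 * cubeFourierCoeff (fun y => sgn (f y)) S else 0) *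
                walsh S x) = f x)).card : ℝ) ≤ B.card := by
        exact_mod_cast card_le_card hsub
    _ = 9 * ((3 : ℝ)⁻¹ ^ 2 * (B.card : ℝ)) := by ring
    _ ≤ 9 * (2 ^ N * tailWeight (fun y => sgn (f y)) D) :=
        mul_le_mul_of_nonneg_left hmk (by norm_num)

/-! ### The stub: `n'` functions, union bound -/

/-- **Stub `stub_truncationSurrogate` of crux `stmt-PneNP-2460` (`SearchHardWindow`), Line A,
AC⁰ rung — the Fourier-truncation surrogate.** For Boolean functions `g_v : {0,1}^N → {0,1}`,
`v < n'`, whose `±1` versions `h_v = sgn ∘ g_v` have Fourier tails `W^{≥D}[h_v] ≤ τ`, the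
coefficients `c v S = if |S| < D then -3 ĥ_v(S) else 0` are supported below level `D`, the
polynomials `p_v = ∑_S c v S χ_S = -3 T_{<D} h_v` have total energy `∑_x ∑_v p_v(x)² ≤ 9 n' 2^N`,
and the points `x` at which some `p_v(x)` fails to have modulus `≥ 1` and the sign of `g_v(x)`
(`0 ≤ p_v(x) ↔ g_v(x) = true`) number at most `9 n' τ 2^N` (Markov on the tails and a union
bound over `v`; O'Donnell 2014, §3.1, after Linial–Mansour–Nisan 1993). The hypothesis `1 ≤ D`
is not needed. [cite: ODonnell2014, §3.1] -/
theorem stub_truncationSurrogate {N n' : ℕ} (D : ℕ) (hD : 1 ≤ D)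
    (g : Fin n' → (Fin N → Bool) → Bool) (τ : ℝ)
    (hτ : ∀ v, tailWeight (fun x => sgn (g v x)) D ≤ τ) :
    ∃ c : Fin n' → Finset (Fin N) → ℝ,
      (∀ v S, D ≤ S.card → c v S = 0) ∧
      (∑ x : Fin N → Bool, ∑ v, (∑ S, c v S * walsh S x) ^ 2 ≤ 9 * n' * 2 ^ N) ∧
      ((univ.filter fun x : Fin N → Bool => ¬ ∀ v, (1 ≤ |∑ S, c v S * walsh S x| ∧
          decide (0 ≤ ∑ S, c v S * walsh S x) = g v x)).card : ℝ) ≤ 9 * n' * τ * 2 ^ N := by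
  -- the level hypothesis `1 ≤ D` of the rung is not needed for the truncation bounds
  have _hD : 1 ≤ D := hD
  clear hD _hD
  refine ⟨fun v S => if S.card < D then -3 * cubeFourierCoeff (fun y => sgn (g v y)) S else 0,
    fun v S hS => if_neg (not_lt.2 hS), ?_, ?_⟩
  · calc ∑ x : Fin N → Bool, ∑ v, (∑ S,
            (if S.card < D then -3 * cubeFourierCoeff (fun y => sgn (g v y)) S else 0) *
              walsh S x) ^ 2
          = ∑ v, ∑ x : Fin N → Bool, (∑ S,
            (if S.card < D then -3 * cubeFourierCoeff (fun y => sgn (g v y)) S else 0) *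
              walsh S x) ^ 2 := Finset.sum_comm
      _ ≤ ∑ _v : Fin n', (9 * 2 ^ N : ℝ) := Finset.sum_le_sum fun v _ => shw_energy D (g v)
      _ = 9 * n' * 2 ^ N := by
          rw [sum_const, card_univ, Fintype.card_fin, nsmul_eq_mul]; ring
  · -- the bad set of `v`, and the union bound
    set bad : Fin n' → Finset (Fin N → Bool) := fun v => (univ : Finset (Fin N → Bool)).filter
      fun x => ¬ (1 ≤ |∑ S,
            (if S.card < D then -3 * cubeFourierCoeff (fun y => sgn (g v y)) S else 0) *
              walsh S x| ∧
          decide (0 ≤ ∑ S,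
            (if S.card < D then -3 * cubeFourierCoeff (fun y => sgn (g v y)) S else 0) *
              walsh S x) = g v x) with hbad
    have hsub : (univ.filter fun x : Fin N → Bool => ¬ ∀ v, (1 ≤ |∑ S,
            (if S.card < D then -3 * cubeFourierCoeff (fun y => sgn (g v y)) S else 0) *
              walsh S x| ∧
          decide (0 ≤ ∑ S,
            (if S.card < D then -3 * cubeFourierCoeff (fun y => sgn (g v y)) S else 0) *
              walsh S x) = g v x)) ⊆ univ.biUnion bad := by
      intro x hx
      rw [mem_biUnion]
      obtain ⟨v, hv⟩ := not_forall.1 (mem_filter.1 hx).2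
      refine ⟨v, mem_univ _, ?_⟩
      rw [hbad, mem_filter]
      exact ⟨mem_univ _, hv⟩
    have hbv : ∀ v,
        ((bad v).card : ℝ) ≤ 9 * (2 ^ N * tailWeight (fun x => sgn (g v x)) D) := by
      intro v
      rw [hbad]
      exact shw_bad_card_le D (g v)
    calc ((univ.filter fun x : Fin N → Bool => ¬ ∀ v, (1 ≤ |∑ S,
            (if S.card < D then -3 * cubeFourierCoeff (fun y => sgn (g v y)) S else 0) *
              walsh S x| ∧
          decide (0 ≤ ∑ S,
            (if S.card < D then -3 * cubeFourierCoeff (fun y => sgn (g v y)) S else 0) *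
              walsh S x) = g v x)).card : ℝ)
          ≤ (univ.biUnion bad).card := by exact_mod_cast card_le_card hsub
      _ ≤ ∑ v, ((bad v).card : ℝ) := by exact_mod_cast card_biUnion_le
      _ ≤ ∑ v, 9 * (2 ^ N * tailWeight (fun x => sgn (g v x)) D) :=
            Finset.sum_le_sum fun v _ => hbv v
      _ ≤ ∑ _v : Fin n', 9 * (2 ^ N * τ) :=
            Finset.sum_le_sum fun v _ =>
              mul_le_mul_of_nonneg_left (mul_le_mul_of_nonneg_left (hτ v) (by positivity))
                (by norm_num)
      _ = 9 * n' * τ * 2 ^ N := by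
          rw [sum_const, card_univ, Fintype.card_fin, nsmul_eq_mul]; ring

end Summit.PneNP.PneNP.Theorems

end
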